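import Mathlib.Combinatorics.SetFamily.Compression.Down
import Mathlib.Tactic
import HarnessLib
import HarnessLib.Audit.Tags
import Summits.CriticalPhenomena.PercolationContinuityZ3.Theorems.PercNearOneGluingNoHeavyLowerTailSahiRainbowTwoColourTwins

/-!
# The two-colouring statement compresses, II: the step at a good point and the reduction to SPARSE configurations

Support file (seat `prim-masterthm-p1`, gen 41; `--supports stmt-CriticalPhenomena-4575`).  No `sorry`, standard axioms.
Companion of `…SahiRainbowTwoColourTwins` (key lemma `pairMeets_upperClass_union_subset_twins`: the monochromatic meets of the
UPPER-coloured doubled configuration at `y` are twins; `proj_config`, `upperClass_config`: the two derived 2-coloured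
complement-closed families on `G.erase y`).  Memo `run/shared/lean/prim/prim-masterthm/FROM-prim-masterthm-p1-g41-TWO-COLOUR.md` §3–§4.

* `card_bothLifts_le_two_mul_twins` — if the weak two-colouring statement and the strict rainbow form hold on `G.erase y` and at
  least three antipodal pairs are doubled at `y` (`#D ≥ 6`), then `#D ≤ 2 · #twins` (degenerate doubled configuration: weak form;
  nondegenerate: it is the antipodal configuration of a non-degenerate complement-free family, strict form).
* `card_le_two_mul_card_monoMeets_of_good` — **THE STEP AT A GOOD POINT** (`#D = 0` or `#D ≥ 6`): `#Z ≤ 2 · #monoMeets X Y`.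
* `card_le_two_mul_card_monoMeets_of_twinPoint` — the same at ANY point with `#D ≤ 2 · #twins` and `#Z ≥ #D + 6` (the form in
  which the sparse residual is to be attacked: exhibit twins; gen 40's `tw_z ≥ k_z + m_z` is the antipodal special case).
* `SparseTwoColourMeets` (typed, [status: open]) — the two-colouring statement for SPARSE configurations (`0 < #D_y < 6`, i.e.
  one or two doubled antipodal pairs, at EVERY `y ∈ G`).
* `twoColourWeakOn_and_rainbowStrictOn_of_sparse` — strong induction on `#G` carrying the strict rainbow form (gen 40's
  `card_add_one_le_card_rainbowMeets_of_not_degenerate`); `twoColourMeets_of_sparse`, `rainbowStrict_of_sparse`,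
  `rainbowMeetCojoin_of_sparse` — **the two-colouring statement (= M3♯), the strict rainbow lemma and the rainbow lemma all
  reduce to the sparse case.**
EVIDENCE for the sparse residual (`prim-masterthm-p1/code-g41/c/`): exhaustive over ALL 4.76·10⁸ sparse configurations on 5
points (`allbad5.c`: some point has `#D ≤ 2·#twins` with the boundary correction; 0 failures), all of `2^4`, samples on 6 points;
the twin count is TIGHT (`#D = 2·#twins` at every point) on the family `{∅} ∪ {G \\ y : y ∈ G} ∪ (perfect matching)`.
HONEST FRAMING: `TwoColourMeets`, `SparseTwoColourMeets`, `RainbowMeetCojoin` remain OPEN; this file is an unconditional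
reduction. [this work]
-/

namespace Summit.CriticalPhenomena.PercolationContinuityZ3.Theorems.SahiColouredDaykin

open Finset
open scoped FinsetFamily

variable {α : Type*} [DecidableEq α]

/-! ### 1. The step at a good point -/

section Step

variable {G : Finset α} {X Y : Finset (Finset α)} {y : α}

/-- The local form of the two-colouring statement on a ground set `G` (weak form, `#Z ≥ 6`). [this work] -/
def TwoColourWeakOn (G : Finset α) : Prop :=
  ∀ X Y : Finset (Finset α), (∀ z ∈ X ∪ Y, z ⊆ G) → (∀ z ∈ X ∪ Y, G \ z ∈ X ∪ Y) → Disjoint X Y →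
    6 ≤ #(X ∪ Y) → #(X ∪ Y) ≤ 2 * #(monoMeets X Y)

/-- **The doubled family is paid by twins**: if the two-colouring statement and the strict rainbow form hold on `G.erase y`
and `#D ≥ 6`, then `#D ≤ 2 · #twins`. [this work] -/
theorem card_bothLifts_le_two_mul_twins (hy : y ∈ G) (hZG : ∀ z ∈ X ∪ Y, z ⊆ G) (hcc : ∀ z ∈ X ∪ Y, G \ z ∈ X ∪ Y)
    (hXY : Disjoint X Y) (IHw : TwoColourWeakOn (G.erase y)) (IHs : RainbowStrictOn (G.erase y))
    (h6 : 6 ≤ #(bothLifts (X ∪ Y) y)) :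
    #(bothLifts (X ∪ Y) y) ≤ 2 * #(bothLifts (monoMeets X Y) y) := by
  set DX := upperClass (X ∪ Y) X y with hDX
  set DY := upperClass (X ∪ Y) Y y with hDY
  obtain ⟨hDG, hDcc, hDdisj⟩ := upperClass_config hy hZG hcc hXY
  have hunion : DX ∪ DY = bothLifts (X ∪ Y) y := upperClass_union X Y y
  have twins := pairMeets_upperClass_union_subset_twins X Y y
  have ctw : #(pairMeets DX ∪ pairMeets DY) ≤ #(bothLifts (monoMeets X Y) y) := card_le_card twins
  rw [← hunion] at h6 ⊢
  by_cases hdeg : (∅ : Finset α) ∈ pairMeets DX ∪ pairMeets DY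
  · -- degenerate: `∅` is already a positive monochromatic meet of `(DX, DY)`
    have hmono : monoMeets DX DY = pairMeets DX ∪ pairMeets DY := by
      unfold monoMeets; rw [insert_eq_of_mem hdeg]
    have := IHw DX DY hDG hDcc hDdisj h6
    rw [hmono] at this
    omega
  · -- nondegenerate: `(DX, DY)` is the antipodal (rainbow) configuration of `DX`; use the strict rainbow form
    set G' := G.erase y with hG'
    have hDXG : ∀ d ∈ DX, d ⊆ G' := fun d hd => hDG d (mem_union_left _ hd)
    have hDYeq : DY = DX.image fun d => G' \ d := by
      ext d
      constructor
      · intro hd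
        have hd' : G' \ d ∈ DX ∪ DY := hDcc d (mem_union_right _ hd)
        rcases mem_union.1 hd' with h | h
        · exact mem_image.2 ⟨G' \ d, h, Finset.sdiff_sdiff_eq_self (hDG d (mem_union_right _ hd))⟩
        · exfalso; apply hdeg
          have hne : d ≠ G' \ d := by
            intro e
            have hdem : d = ∅ := by
              apply eq_empty_of_forall_notMem; intro t ht
              have ht' := ht; rw [e] at ht'; exact (mem_sdiff.1 ht').2 ht
            -- then every member of `DX ∪ DY` is `∅`: impossible as `#(DX ∪ DY) ≥ 6`
            have hG'e : G' = ∅ := by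
              have : G' \ d = ∅ := by rw [← e, hdem]
              rwa [hdem, sdiff_empty] at this
            have : #(DX ∪ DY) ≤ 1 := by
              apply card_le_one.2
              intro a ha b hb
              have ha' := hDG a ha; have hb' := hDG b hb
              rw [hG'e, subset_empty] at ha' hb'
              rw [ha', hb']
            omega
          have : d ∩ (G' \ d) = ∅ := inter_sdiff_self d G'
          rw [← this]
          exact mem_union_right _ (inter_mem_pairMeets hd h hne)
      · intro hd
        obtain ⟨x, hx, rfl⟩ := mem_image.1 hd
        have hx' : G' \ x ∈ DX ∪ DY := hDcc x (mem_union_left _ hx)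
        rcases mem_union.1 hx' with h | h
        · exfalso; apply hdeg
          have hne : x ≠ G' \ x := by
            intro e
            have hxem : x = ∅ := by
              apply eq_empty_of_forall_notMem; intro t ht
              have ht' := ht; rw [e] at ht'; exact (mem_sdiff.1 ht').2 ht
            have hG'e : G' = ∅ := by
              have : G' \ x = ∅ := by rw [← e, hxem]
              rwa [hxem, sdiff_empty] at this
            have : #(DX ∪ DY) ≤ 1 := by
              apply card_le_one.2
              intro a ha b hb
              have ha' := hDG a ha; have hb' := hDG b hb
              rw [hG'e, subset_empty] at ha' hb'
              rw [ha', hb']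
            omega
          have : x ∩ (G' \ x) = ∅ := inter_sdiff_self x G'
          rw [← this]
          exact mem_union_left _ (inter_mem_pairMeets hx h hne)
        · exact h
    have hDXcf : ∀ d ∈ DX, G' \ d ∉ DX := by
      intro d hd h
      have : G' \ d ∈ DY := hDYeq ▸ mem_image.2 ⟨d, hd, rfl⟩
      exact disjoint_left.1 hDdisj h this
    -- the positive colours of the rainbow configuration of `DX` are `pairMeets DX ∪ pairMeets DY`
    have hpos : posRainbow G' DX = pairMeets DX ∪ pairMeets DY := by
      unfold posRainbow; rw [hDYeq, pairMeets_image_sdiff hDXG]; rfl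
    have hnd : ¬ RainbowDegenerate G' DX := by unfold RainbowDegenerate; rw [hpos]; exact hdeg
    have cDY : #DY = #DX := by
      rw [hDYeq]
      apply card_image_of_injOn
      intro a ha b hb hab
      have := congrArg (fun s => G' \ s) hab
      simpa only [Finset.sdiff_sdiff_eq_self (hDXG a ha), Finset.sdiff_sdiff_eq_self (hDXG b hb)] using this
    have cD : #(DX ∪ DY) = 2 * #DX := by rw [card_union_of_disjoint hDdisj, cDY]; ring
    have h2 : 2 ≤ #DX := by omega
    have strict := (IHs DX hDXG hDXcf).2 h2 hnd
    rw [card_rainbowMeets_of_not_degenerate hnd, hpos] at strict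
    omega

/-- **THE STEP AT A GOOD POINT.**  If the two-colouring statement and the strict rainbow form hold on `G.erase y`, and at `y`
either no member is doubled or at least three antipodal pairs are (`#D = 0 ∨ #D ≥ 6`), then `#Z ≤ 2 · #monoMeets X Y`. [this work] -/
theorem card_le_two_mul_card_monoMeets_of_good (hy : y ∈ G) (hZG : ∀ z ∈ X ∪ Y, z ⊆ G) (hcc : ∀ z ∈ X ∪ Y, G \ z ∈ X ∪ Y)
    (hXY : Disjoint X Y) (h6 : 6 ≤ #(X ∪ Y)) (IHw : TwoColourWeakOn (G.erase y)) (IHs : RainbowStrictOn (G.erase y))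
    (hgood : #(bothLifts (X ∪ Y) y) = 0 ∨ 6 ≤ #(bothLifts (X ∪ Y) y)) :
    #(X ∪ Y) ≤ 2 * #(monoMeets X Y) := by
  set X' := X.image fun s => s.erase y with hX'
  set Y' := (Y.image fun s => s.erase y) \ X' with hY'
  obtain ⟨hZ'G, hcc', hXY'⟩ := proj_config (y := y) hZG hcc
  have cZ : #(X' ∪ Y') + #(bothLifts (X ∪ Y) y) = #(X ∪ Y) := by
    rw [hY', hX', proj_union, card_image_erase_add_card_bothLifts]
  have cL := card_image_erase_add_card_bothLifts (monoMeets X Y) y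
  have cproj : #(monoMeets X' Y') ≤ #((monoMeets X Y).image fun s => s.erase y) :=
    card_le_card (monoMeets_proj_subset X Y y)
  have hDsub : bothLifts (X ∪ Y) y ⊆ X' ∪ Y' := by
    rw [hY', hX', proj_union]; exact bothLifts_subset_image_erase _ _
  have h6' : 6 ≤ #(X' ∪ Y') := by
    rcases hgood with h0 | h6D
    · omega
    · exact h6D.trans (card_le_card hDsub)
  have IHZ' := IHw X' Y' hZ'G hcc' hXY' h6'
  rcases hgood with h0 | h6D
  · omega
  · have := card_bothLifts_le_two_mul_twins hy hZG hcc hXY IHw IHs h6D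
    omega

/-- **THE STEP AT A TWIN POINT.**  At any point where the doubled members are paid by twins (`#D ≤ 2 · #twins`) and the
projected configuration is large (`#Z ≥ #D + 6`), the two-colouring statement on `G.erase y` gives `#Z ≤ 2 · #monoMeets X Y`.
This is the form in which the sparse residual is to be attacked: EXHIBIT TWINS. [this work] -/
theorem card_le_two_mul_card_monoMeets_of_twinPoint (hZG : ∀ z ∈ X ∪ Y, z ⊆ G) (hcc : ∀ z ∈ X ∪ Y, G \ z ∈ X ∪ Y)
    (h6 : #(bothLifts (X ∪ Y) y) + 6 ≤ #(X ∪ Y)) (IHw : TwoColourWeakOn (G.erase y))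
    (htw : #(bothLifts (X ∪ Y) y) ≤ 2 * #(bothLifts (monoMeets X Y) y)) :
    #(X ∪ Y) ≤ 2 * #(monoMeets X Y) := by
  set X' := X.image fun s => s.erase y with hX'
  set Y' := (Y.image fun s => s.erase y) \ X' with hY'
  obtain ⟨hZ'G, hcc', hXY'⟩ := proj_config (y := y) hZG hcc
  have cZ : #(X' ∪ Y') + #(bothLifts (X ∪ Y) y) = #(X ∪ Y) := by
    rw [hY', hX', proj_union, card_image_erase_add_card_bothLifts]
  have cL := card_image_erase_add_card_bothLifts (monoMeets X Y) y
  have cproj : #(monoMeets X' Y') ≤ #((monoMeets X Y).image fun s => s.erase y) :=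
    card_le_card (monoMeets_proj_subset X Y y)
  have IHZ' := IHw X' Y' hZ'G hcc' hXY' (by omega)
  omega

end Step

/-! ### 2. The reduction to sparse configurations -/

/-- **CONJECTURE (the sparse residual; typed).**  The two-colouring statement for SPARSE configurations: complement-closed
`Z = X ⊔ Y ⊆ 2^G`, `#Z ≥ 6`, such that at EVERY point `y ∈ G` the number of doubled members `#(bothLifts Z y) = 2 p_y` lies
strictly between `0` and `6` (one or two antipodal pairs of `y`-edges).  By `twoColourMeets_of_sparse` this is ALL that is
missing for `TwoColourMeets` (= `ThreeFamilyTwin`) and hence for `RainbowMeetCojoin`; by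
`card_le_two_mul_card_monoMeets_of_twinPoint` it suffices to find ONE point with `#D ≤ 2 · #twins`.  EVIDENCE
(`prim-masterthm-p1/code-g41/c/allbad5.c`, `sparse_supports.c`): exhaustive over all 13 600 sparse supports × all colourings
(4.76·10⁸ configurations) on 5 points and all of 2^≤4: a twin point always exists (with the true twin count); the twin count is
tight at every point on `{∅, G∖y (y ∈ G)} ∪ matching` (n ≥ 6). [this work] [status: open] -/
@[conjecture] def SparseTwoColourMeets (α : Type*) [DecidableEq α] : Prop :=
  ∀ (G : Finset α) (X Y : Finset (Finset α)),
    (∀ z ∈ X ∪ Y, z ⊆ G) → (∀ z ∈ X ∪ Y, G \ z ∈ X ∪ Y) → Disjoint X Y → 6 ≤ #(X ∪ Y) →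
    (∀ y ∈ G, 0 < #(bothLifts (X ∪ Y) y) ∧ #(bothLifts (X ∪ Y) y) < 6) →
    #(X ∪ Y) ≤ 2 * #(monoMeets X Y)

section Reduction

variable {G : Finset α}

/-- The weak rainbow inequality on `G` from the two-colouring statement on `G` (antipodal colouring; at most two members
directly). [this work] -/
theorem card_le_card_rainbowMeets_of_twoColourWeakOn (hw : TwoColourWeakOn G) {𝒜 : Finset (Finset α)}
    (h𝒜G : ∀ a ∈ 𝒜, a ⊆ G) (hcf : ∀ a ∈ 𝒜, G \ a ∉ 𝒜) : #𝒜 ≤ #(rainbowMeets G 𝒜) := by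
  by_cases h3 : 3 ≤ #𝒜
  · set Y := 𝒜.image fun a => G \ a with hY
    have hZG : ∀ z ∈ 𝒜 ∪ Y, z ⊆ G := by
      intro z hz
      rcases mem_union.1 hz with hz | hz
      · exact h𝒜G z hz
      · obtain ⟨a, _, rfl⟩ := mem_image.1 hz; exact sdiff_subset
    have hcc : ∀ z ∈ 𝒜 ∪ Y, G \ z ∈ 𝒜 ∪ Y := fun z hz => sdiff_mem_union_image h𝒜G hz
    have hXY : Disjoint 𝒜 Y := by
      rw [disjoint_left]; intro a ha ha'
      obtain ⟨b, hb, hba⟩ := mem_image.1 ha'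
      exact hcf b hb (hba ▸ ha)
    have cZ : #(𝒜 ∪ Y) = 2 * #𝒜 := card_union_image_sdiff h𝒜G hcf
    have := hw 𝒜 Y hZG hcc hXY (by omega)
    rw [monoMeets_eq_rainbowMeets h𝒜G, cZ] at this
    omega
  · push Not at h3
    by_cases h2 : 2 ≤ #𝒜
    · obtain ⟨a, ha, b, hb, hab⟩ := one_lt_card.1 h2
      have := two_le_card_rainbowMeets_of_pair h𝒜G hcf ha hb hab
      omega
    · have : 0 < #(rainbowMeets G 𝒜) := card_pos.2 ⟨∅, mem_rainbowMeets_iff.2 (Or.inl rfl)⟩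
      omega

/-- **The induction.**  Under `SparseTwoColourMeets`, every ground set satisfies the weak two-colouring statement AND the strict
rainbow form `RainbowStrictOn`. [this work] -/
theorem twoColourWeakOn_and_rainbowStrictOn_of_sparse (hR : SparseTwoColourMeets α) (G : Finset α) :
    TwoColourWeakOn G ∧ RainbowStrictOn G := by
  induction' hn : #G using Nat.strong_induction_on with n ihn generalizing G
  have IH : ∀ y ∈ G, TwoColourWeakOn (G.erase y) ∧ RainbowStrictOn (G.erase y) := fun y hy =>
    ihn #(G.erase y) (by rw [← hn]; exact card_erase_lt_of_mem hy) (G.erase y) rfl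
  -- Part B: the weak two-colouring statement on `G`
  have weak : TwoColourWeakOn G := by
    intro X Y hZG hcc hXY h6
    by_cases hgood : ∃ y ∈ G, #(bothLifts (X ∪ Y) y) = 0 ∨ 6 ≤ #(bothLifts (X ∪ Y) y)
    · obtain ⟨y, hy, hgood⟩ := hgood
      exact card_le_two_mul_card_monoMeets_of_good hy hZG hcc hXY h6 (IH y hy).1 (IH y hy).2 hgood
    · push Not at hgood
      exact hR G X Y hZG hcc hXY h6 fun y hy => by have := hgood y hy; omega
  refine ⟨weak, ?_⟩
  -- Part A: the strict rainbow form on `G`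
  intro 𝒞 h𝒞G hcf
  refine ⟨card_le_card_rainbowMeets_of_twoColourWeakOn weak h𝒞G hcf, fun h2 hnd => ?_⟩
  have hGne : G.Nonempty := by
    rw [nonempty_iff_ne_empty]; rintro rfl
    obtain ⟨c, hc, d, hd, hcd⟩ := one_lt_card.1 h2
    exact hcd ((subset_empty.1 (h𝒞G c hc)).trans (subset_empty.1 (h𝒞G d hd)).symm)
  obtain ⟨r, hr⟩ := hGne
  exact card_add_one_le_card_rainbowMeets_of_not_degenerate hr h𝒞G hcf h2 hnd (IH r hr).2

/-- **`SparseTwoColourMeets ⟹ TwoColourMeets`**: the two-colouring statement (= `ThreeFamilyTwin`) reduces to its sparse case.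
[this work] -/
theorem twoColourMeets_of_sparse (hR : SparseTwoColourMeets α) : TwoColourMeets α :=
  fun G X Y hZG hcc hXY h6 => (twoColourWeakOn_and_rainbowStrictOn_of_sparse hR G).1 X Y hZG hcc hXY h6

/-- **`SparseTwoColourMeets ⟹ RainbowStrict`** (the strict rainbow lemma of gen 40). [this work] -/
theorem rainbowStrict_of_sparse (hR : SparseTwoColourMeets α) : RainbowStrict α :=
  fun G => (twoColourWeakOn_and_rainbowStrictOn_of_sparse hR G).2

/-- **`SparseTwoColourMeets ⟹ RainbowMeetCojoin`**: the rainbow lemma reduces to the sparse two-colouring statement. [this work] -/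
theorem rainbowMeetCojoin_of_sparse (hR : SparseTwoColourMeets α) : RainbowMeetCojoin α :=
  rainbowMeetCojoin_of_twoColourMeets (twoColourMeets_of_sparse hR)

end Reduction

end Summit.CriticalPhenomena.PercolationContinuityZ3.Theorems.SahiColouredDaykin
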